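import Mathlib
import Summits.KontsevichZagierPeriods.Zeta5Search.BrickKernelFrobenius
import Literature.NumberTheory.Congruences.LjunggrenBinomialCongruence
import Literature.NumberTheory.Congruences.WolstenholmeTheorem

/-!
# BrickPhiFour — LEMMA Φ4: the next `p`-adic digit of the Frobenius factor of the brick kernel,
`Φ_{n,p}(−j) ≡ 1 + λ_p·q_n(j) (mod p⁴)`, `λ_p = p·H_{p−1}` (cell zeta5-irr)

HONEST FRAMING: systematic search; no irrationality claim unless certified. INSTRUMENT lemma of the ζ(5)
census cell zeta5-irr (HOME `run/shared/lean/pub/zeta5-irr/`; memo `zi-p2/LEMMAS.md` §B8-a′ LEMMA Φ4 = the input of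
§B8-a″ THEOREM 5 Step D). Nothing here is about ζ(5); no irrationality content; filing moves no rung. Filed by the
engine seat zi-eng (g7) on zi-p2's request (HOME INBOX 2026-08-26T19:31:41Z (2) / 19:38:33Z (ii): «LEMMA Φ4 types
UNCONDITIONALLY over brickPhi as Φ_{n,p}(−j) ≡ 1 + λ_p·q_n(j) (mod p⁴), λ_p := p·H_{p−1} j-independent, v_p(λ_p) ≥ 3»).

## The statement and its proof

`p ≥ 5` prime, `2B ≤ A`, `n ∈ ℕ`, `j ∈ ℤ`; `Φ_{n,p}(t) = W^{A−2B}·∏_{p∤ℓ≤np}(pt−ℓ)^B·∏_{p∤ℓ≤np}(pt+np+ℓ)^B /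
∏_{p∤ℓ≤np}(pt+ℓ)^A`, `W = ∏_{p∤ℓ≤np} ℓ` (tree: `BrickKernelFrobenius.brickPhi`, with `brickKernel_frobenius :
p^A·R_{np}(pt) = p^ε·Φ_{n,p}(t)·R_n(t)`). At `t = −j` each of the four products is a product of COMPLETE residue
blocks `∏_{0<r<p}(bp + r)`: `W ↔ b ∈ [0,n)`, `∏(−jp−ℓ) ↔ b ∈ [j, j+n)` (sign `(−1)^{n(p−1)} = +1`),
`∏((n−j)p+ℓ) ↔ b ∈ [n−j, 2n−j)`, `∏(ℓ−jp) ↔ b ∈ [−j, n−j)`. The block congruence modulo `p⁴` (Glaisher 1900; tree: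
`Ljunggren.prod_mul_add_modEq_pow_four`) reads `∏_{0<r<p}(bp + r) ≡ (p−1)!·(1 + b(b+1)·λ_p) (mod p⁴)`,
`λ_p := p·A_{p−2}/(p−1)! = p·H_{p−1}`, `v_p(λ_p) ≥ 3` (Wolstenholme), so `λ_p² ≡ 0` and the `(p−1)!`-powers cancel
(`(A−2B)n + Bn + Bn = An`). Hence, with the BLOCK MOMENT `M_n(c) := Σ_{b<n}(c+b)(c+b+1)` and
`q := (A−2B)·M_n(0) + B·M_n(j) + B·M_n(n−j) − A·M_n(−j)` (zi-p2: «`Σ ±b(b+1)` over the blocks, numerator `+`,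
denominator `−`, with multiplicity»): **`Φ_{n,p}(−j) ≡ 1 + λ_p·q (mod p⁴)`**, i.e. `v_p(Φ_{n,p}(−j) − 1 − λ_p·q) ≥ 4`.
For `0 ≤ j ≤ n`, `q` is zi-p2's cubic `q_n(j) = B·S(j,j+n−1) + B·S(n−j,2n−j−1) − A·(S(0,n−j−1) + S(0,j−1)) +
(A−2B)·S(0,n−1)`, `S(a,b) = Σ_{x=a}^{b} x(x+1)` (HOME `zi-p2/SketchT5.lean`, `ZiP2.B8.T5.qBall`). The VALUE
`λ_p ≡ −p³B_{p−3}/3 (mod p⁴)` (Glaisher; tree `GlaisherHarmonicCongruences`) is not needed (zi-p2: «cosmetic»).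

## What is PROVED here (everything; standard axioms)

* `blockMoment`, `phiMoment` (`q` in block form), `S2`, `qBall` (zi-p2's closed form, verbatim),
  `phiMoment_natCast_eq_qBall` (`q = q_n(j)` for `0 ≤ j ≤ n`);
* **`factorial_mul_num_modEq_den_mul`** — Φ4 cleared of denominators: `(p−1)!·W^{A−2B}·P₁^B·P₂^B ≡
  D^A·((p−1)! + Λ_p·q) (mod p⁴)`, `P₁ = ∏_{p∤ℓ}(jp+ℓ)`, `P₂ = ∏_{p∤ℓ}((n−j)p+ℓ)`, `D = ∏_{p∤ℓ}(ℓ−jp)`, `Λ_p = p·A_{p−2}`;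
* **`padicValuation_brickPhi_sub_le`** — Φ4 for `brickPhi` over `ℚ`: `v_p(Φ_{n,p}(−j) − 1 − p·H_{p−1}·q) ≥ 4`
  (as `Rat.padicValuation p (…) ≤ exp (−4)`), every `n`, every `j ∈ ℤ`;
* `padicValuation_prime_mul_harmonic_le` — `v_p(p·H_{p−1}) ≥ 3` (Wolstenholme, from the tree).

Not covered: the Taylor coefficients `Φ′(−j), Φ″(−j)/2, …` modulo `p³` (THEOREM 5 Step B's `φ_m`, `m ≥ 1`).
-/

namespace Summit.KontsevichZagierPeriods.Zeta5Search.BrickPhiFour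

open Finset Nat WithZero
open Summit.KontsevichZagierPeriods.Zeta5Search.FrobeniusFactorisation (prod_filter_not_dvd_eq_prod_prod
  not_dvd_prod_filter_sub_mul)
open Summit.KontsevichZagierPeriods.Zeta5Search.BrickKernelFrobenius (brickPhi)
open Literature.NumberTheory.Congruences

/-! ## The block moment and LEMMA Φ4's cubic -/

/-- The **block moment** `M_n(c) := Σ_{b<n} (c+b)(c+b+1)`: the sum of `b(b+1)` over the `n` consecutive residue
blocks `b = c, c+1, …, c+n−1`. -/
def blockMoment (n : ℕ) (c : ℤ) : ℤ := ∑ b ∈ range n, (c + b) * (c + b + 1)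

/-- **LEMMA Φ4's moment `q` in block form** for the kernel `(A,B,·)` at the digit point `−j`:
`q = (A−2B)·M_n(0) + B·M_n(j) + B·M_n(n−j) − A·M_n(−j)` (blocks of `W`, of `∏(pt−ℓ)`, of `∏(pt+np+ℓ)`, counted
`+`, blocks of the denominator `∏(pt+ℓ)` counted `−`, with multiplicity). -/
def phiMoment (A B n : ℕ) (j : ℤ) : ℤ :=
  ((A - 2 * B : ℕ) : ℤ) * blockMoment n 0 + (B : ℤ) * blockMoment n j +
    (B : ℤ) * blockMoment n ((n : ℤ) - j) - (A : ℤ) * blockMoment n (-j)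

/-- `S(a,b) = Σ_{x=a}^{b} x(x+1)` (empty sum `= 0` when `b < a`) — verbatim `ZiP2.B8.T5.S2` of HOME
`zi-p2/SketchT5.lean`. -/
def S2 (a b : ℕ) : ℤ := ∑ x ∈ Icc a b, ((x : ℤ) * (x + 1))

/-- LEMMA Φ4's cubic `q_n(j) = B·S(j, j+n−1) + B·S(n−j, 2n−j−1) − A·(S(0,n−j−1) + S(0,j−1)) + (A−2B)·S(0,n−1)`
(for `j ≤ n`) — verbatim `ZiP2.B8.T5.qBall` of HOME `zi-p2/SketchT5.lean` (zi-p2 LEMMAS §B8-a′ LEMMA Φ4). -/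
def qBall (A B n j : ℕ) : ℤ :=
  (B : ℤ) * S2 j (j + n - 1) + (B : ℤ) * S2 (n - j) (2 * n - j - 1)
    - (A : ℤ) * (S2 0 (n - j - 1) + S2 0 (j - 1)) + ((A : ℤ) - 2 * B) * S2 0 (n - 1)

/-- `M_n(c) = S(c, c+n−1)` for a natural number `c`. -/
theorem blockMoment_natCast (n c : ℕ) : blockMoment n (c : ℤ) = S2 c (c + n - 1) := by
  unfold blockMoment S2
  cases n with
  | zero =>
    rw [Finset.sum_range_zero]
    cases c with
    | zero => simp
    | succ c => rw [Finset.Icc_eq_empty (by omega), Finset.sum_empty]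
  | succ k =>
    rw [show c + (k + 1) - 1 = c + k by omega, ← Finset.Ico_add_one_right_eq_Icc, Finset.sum_Ico_eq_sum_range,
      show c + k + 1 - c = k + 1 by omega]
    exact Finset.sum_congr rfl fun x _ => by push_cast; ring

/-- `M_n(−j) = S(0, j−1) + S(0, n−j−1)` for `0 ≤ j ≤ n` (the blocks `b − j`, `b < n`, straddle `0`; a negative
block `−k` has the same moment `(−k)(−k+1) = (k−1)k` as the block `k − 1`). -/
theorem blockMoment_neg_natCast {n j : ℕ} (hjn : j ≤ n) :
    blockMoment n (-(j : ℤ)) = S2 0 (j - 1) + S2 0 (n - j - 1) := by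
  obtain ⟨d, rfl⟩ : ∃ d, n = j + d := ⟨n - j, by omega⟩
  have h0 : ∀ m : ℕ, S2 0 (m - 1) = blockMoment m 0 := fun m => by
    rw [show (0 : ℤ) = ((0 : ℕ) : ℤ) from rfl, blockMoment_natCast, Nat.zero_add]
  rw [show j + d - j - 1 = d - 1 by omega, h0, h0]
  unfold blockMoment
  rw [Finset.sum_range_add]
  congr 1
  · rw [← Finset.sum_range_reflect (fun x => (-(j : ℤ) + x) * (-(j : ℤ) + x + 1)) j]
    refine Finset.sum_congr rfl fun x hx => ?_
    rw [Finset.mem_range] at hx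
    have e : ((j - 1 - x : ℕ) : ℤ) = (j : ℤ) - 1 - x := by
      rw [Nat.sub_sub, Nat.cast_sub (by omega)]; push_cast; ring
    rw [e]; ring
  · exact Finset.sum_congr rfl fun x _ => by push_cast; ring

/-- **`q = q_n(j)`**: for `2B ≤ A` and `0 ≤ j ≤ n` the block-form moment is zi-p2's cubic `qBall`. -/
theorem phiMoment_natCast_eq_qBall {A B n j : ℕ} (hAB : 2 * B ≤ A) (hjn : j ≤ n) :
    phiMoment A B n (j : ℤ) = qBall A B n j := by
  unfold phiMoment qBall
  rw [show (0 : ℤ) = ((0 : ℕ) : ℤ) from rfl, blockMoment_natCast, Nat.zero_add, blockMoment_natCast,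
    show ((n : ℤ) - (j : ℤ)) = ((n - j : ℕ) : ℤ) by push_cast [Nat.cast_sub hjn]; ring, blockMoment_natCast,
    show n - j + n - 1 = 2 * n - j - 1 by omega, blockMoment_neg_natCast hjn, Nat.cast_sub hAB]
  push_cast
  ring

/-! ## Nilpotent bookkeeping: products of `1 + x·μ` with `μ² = 0` -/

section nilpotent

variable {R : Type*} [CommRing R] {μ : R}

/-- `∏_{b<n}(1 + x_b μ) = 1 + (Σ_{b<n} x_b)·μ` when `μ² = 0`. [folklore] -/
private theorem prod_one_add_mul (hμ : μ * μ = 0) (x : ℕ → R) (n : ℕ) :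
    ∏ b ∈ range n, (1 + x b * μ) = 1 + (∑ b ∈ range n, x b) * μ := by
  induction n with
  | zero => simp
  | succ n ih =>
    rw [Finset.prod_range_succ, ih, Finset.sum_range_succ]
    linear_combination ((∑ b ∈ range n, x b) * x n) * hμ

/-- `(1 + x μ)^k = 1 + k·x·μ` when `μ² = 0`. [folklore] -/
private theorem one_add_mul_pow (hμ : μ * μ = 0) (x : R) (k : ℕ) :
    (1 + x * μ) ^ k = 1 + (k : R) * x * μ := by
  have h := prod_one_add_mul hμ (fun _ => x) k
  rw [Finset.prod_const, Finset.card_range, Finset.sum_const, Finset.card_range, nsmul_eq_mul] at h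
  rw [h]

/-- The assembly identity behind Φ4: with `L² = 0`, `uF = 1`,
`F·[Fⁿᵃ(1 + a m₀ Lu)]·[FⁿB(1 + B m₁ Lu)]·[FⁿB(1 + B m₂ Lu)] = Fⁿ⁽ᵃ⁺²ᴮ⁾(1 + (a+2B) m₃ Lu)·(F + L·q)`,
`q = a m₀ + B m₁ + B m₂ − (a+2B) m₃`. [folklore] -/
private theorem assembly {F L u m₀ m₁ m₂ m₃ : R} (hL : L * L = 0) (hu : u * F = 1) (n a B : ℕ) :
    F * ((F ^ n) ^ a * (1 + (a : R) * m₀ * (L * u))) * ((F ^ n) ^ B * (1 + (B : R) * m₁ * (L * u))) *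
        ((F ^ n) ^ B * (1 + (B : R) * m₂ * (L * u))) =
      (F ^ n) ^ (a + 2 * B) * (1 + ((a + 2 * B : ℕ) : R) * m₃ * (L * u)) *
        (F + L * ((a : R) * m₀ + B * m₁ + B * m₂ - ((a + 2 * B : ℕ) : R) * m₃)) := by
  push_cast
  rw [show (F ^ n) ^ (a + 2 * B) = (F ^ n) ^ a * (F ^ n) ^ B * (F ^ n) ^ B by ring]
  set P : R := (F ^ n) ^ a * (F ^ n) ^ B * (F ^ n) ^ B
  set α : R := (a : R) * m₀
  set β : R := (B : R) * m₁
  set γ : R := (B : R) * m₂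
  set δ : R := ((a : R) + 2 * (B : R)) * m₃
  linear_combination (P * L * (α + β + γ - δ)) * hu +
    (P * (-(δ * (α + β + γ - δ) * u) + F * (α * β + α * γ + β * γ) * u ^ 2 + F * α * β * γ * L * u ^ 3)) * hL

end nilpotent

/-! ## The four products of `Φ_{n,p}(−j)` as residue blocks, modulo `p⁴` -/

section blocks

variable {p : ℕ}

/-- `Λ_p² ≡ 0 (mod p⁴)`, `Λ_p = p·A_{p−2}`: Wolstenholme's `p² ∣ A_{p−2}` (tree:
`Wolstenholme.sq_dvd_sum_factorial_div`) gives `p⁶ ∣ Λ_p²`. -/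
private theorem lambda_mul_lambda (hp : p.Prime) (h3 : 3 < p) :
    ((p * ∑ i ∈ Icc 1 (p - 1), (p - 1)! / i : ℕ) : ZMod (p ^ 4)) *
        ((p * ∑ i ∈ Icc 1 (p - 1), (p - 1)! / i : ℕ) : ZMod (p ^ 4)) = 0 := by
  obtain ⟨c, hc⟩ := Wolstenholme.sq_dvd_sum_factorial_div hp h3
  rw [← Nat.cast_mul, ZMod.natCast_eq_zero_iff, hc]
  exact ⟨p ^ 2 * c ^ 2, by ring⟩

/-- … hence `(Λ_p·u)² = 0` in `ℤ/p⁴` for every `u`. -/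
private theorem lambda_mul_sq (hp : p.Prime) (h3 : 3 < p) (u : ZMod (p ^ 4)) :
    ((p * ∑ i ∈ Icc 1 (p - 1), (p - 1)! / i : ℕ) : ZMod (p ^ 4)) * u *
        (((p * ∑ i ∈ Icc 1 (p - 1), (p - 1)! / i : ℕ) : ZMod (p ^ 4)) * u) = 0 := by
  linear_combination (u * u) * lambda_mul_lambda hp h3

/-- `(p−1)!` is a unit modulo `p⁴`. -/
private theorem exists_inv_factorial (hp : p.Prime) :
    ∃ u : ZMod (p ^ 4), u * (((p - 1)! : ℕ) : ZMod (p ^ 4)) = 1 := by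
  have hc : Nat.Coprime (p - 1)! (p ^ 4) := by
    refine Nat.Coprime.pow_right 4 (Nat.coprime_comm.1 ((Nat.Prime.coprime_iff_not_dvd hp).2 ?_))
    rw [hp.dvd_factorial]
    have := hp.one_lt
    omega
  exact ⟨(((ZMod.unitOfCoprime _ hc)⁻¹ : (ZMod (p ^ 4))ˣ) : ZMod (p ^ 4)),
    by rw [← ZMod.coe_unitOfCoprime _ hc, Units.inv_mul]⟩

/-- One block modulo `p⁴` in product form: `∏_{0<r<p}(mp + r) = (p−1)!·(1 + m(m+1)·Λ_p·u)` in `ℤ/p⁴`, where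
`u = ((p−1)!)⁻¹` (tree: `Ljunggren.prod_mul_add_modEq_pow_four`). -/
private theorem block_eq (hp : p.Prime) (h3 : 3 < p) {u : ZMod (p ^ 4)}
    (hu : u * (((p - 1)! : ℕ) : ZMod (p ^ 4)) = 1) (m : ℤ) :
    ((∏ r ∈ Icc 1 (p - 1), (m * p + (r : ℤ)) : ℤ) : ZMod (p ^ 4)) =
      (((p - 1)! : ℕ) : ZMod (p ^ 4)) *
        (1 + ((m * (m + 1) : ℤ) : ZMod (p ^ 4)) *
          (((p * ∑ i ∈ Icc 1 (p - 1), (p - 1)! / i : ℕ) : ZMod (p ^ 4)) * u)) := by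
  set Ap : ℕ := ∑ i ∈ Icc 1 (p - 1), (p - 1)! / i with hAp
  set F : ℕ := (p - 1)! with hF
  have h := Ljunggren.prod_mul_add_modEq_pow_four hp h3 m
  rw [← hAp, ← hF, (Nat.cast_pow p 4).symm] at h
  have h' := (ZMod.intCast_eq_intCast_iff _ _ (p ^ 4)).2 h
  rw [h']
  push_cast
  linear_combination (-((m : ZMod (p ^ 4)) * (m + 1) * p * Ap)) * hu

/-- **The products of `Φ_{n,p}(−j)` as blocks, modulo `p⁴`**: for every `c ∈ ℤ`,
`∏_{1≤ℓ≤np, p∤ℓ}(cp + ℓ) = ∏_{b<n}∏_{0<r<p}((c+b)p + r) = ((p−1)!)ⁿ·(1 + M_n(c)·Λ_p·u)` in `ℤ/p⁴`. -/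
private theorem cast_prod_filter_eq (hp : p.Prime) (h3 : 3 < p) {u : ZMod (p ^ 4)}
    (hu : u * (((p - 1)! : ℕ) : ZMod (p ^ 4)) = 1) (n : ℕ) (c : ℤ) :
    ((∏ m ∈ (Icc 1 (n * p)).filter (fun m => ¬ p ∣ m), (c * p + (m : ℤ)) : ℤ) : ZMod (p ^ 4)) =
      (((p - 1)! : ℕ) : ZMod (p ^ 4)) ^ n *
        (1 + ((blockMoment n c : ℤ) : ZMod (p ^ 4)) *
          (((p * ∑ i ∈ Icc 1 (p - 1), (p - 1)! / i : ℕ) : ZMod (p ^ 4)) * u)) := by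
  rw [prod_filter_not_dvd_eq_prod_prod hp.pos n (fun m => c * p + (m : ℤ)), Int.cast_prod]
  have hblock : ∀ b ∈ range n,
      (((∏ r ∈ Icc 1 (p - 1), (c * p + ((b * p + r : ℕ) : ℤ))) : ℤ) : ZMod (p ^ 4)) =
        (((p - 1)! : ℕ) : ZMod (p ^ 4)) *
          (1 + ((((c + b) * (c + b + 1) : ℤ)) : ZMod (p ^ 4)) *
            (((p * ∑ i ∈ Icc 1 (p - 1), (p - 1)! / i : ℕ) : ZMod (p ^ 4)) * u)) := by
    intro b _
    have e : ∏ r ∈ Icc 1 (p - 1), (c * p + ((b * p + r : ℕ) : ℤ)) =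
        ∏ r ∈ Icc 1 (p - 1), ((c + b) * p + (r : ℤ)) :=
      Finset.prod_congr rfl fun r _ => by push_cast; ring
    rw [e]
    exact block_eq hp h3 hu (c + b)
  rw [Finset.prod_congr rfl hblock, Finset.prod_mul_distrib, Finset.prod_const, Finset.card_range,
    prod_one_add_mul (lambda_mul_sq hp h3 u) (fun b => ((((c + b) * (c + b + 1) : ℤ)) : ZMod (p ^ 4))) n]
  simp only [blockMoment, Int.cast_sum]

/-- **LEMMA Φ4 cleared of denominators** (zi-p2 LEMMAS §B8-a′ LEMMA Φ4, Bernoulli-free form of HOME INBOX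
2026-08-26T19:38:33Z (ii)): for a prime `p ≥ 5`, `2B ≤ A`, every `n` and every `j ∈ ℤ`, with `W = ∏_{1≤ℓ≤np, p∤ℓ} ℓ`,
`P₁ = ∏(jp + ℓ)`, `P₂ = ∏((n−j)p + ℓ)`, `D = ∏(ℓ − jp)` (same range), `Λ_p = p·Σ_{0<i<p}(p−1)!/i`, `q = phiMoment A B n j`:
`(p−1)!·W^{A−2B}·P₁^B·P₂^B ≡ D^A·((p−1)! + Λ_p·q) (mod p⁴)` — i.e. `Φ_{n,p}(−j) = W^{A−2B}P₁^BP₂^B/D^A ≡ 1 + λ_p·q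
(mod p⁴)`, `λ_p = Λ_p/(p−1)!`, as `D` and `(p−1)!` are prime to `p`. -/
theorem factorial_mul_num_modEq_den_mul (hp : p.Prime) (h3 : 3 < p) {A B : ℕ} (hAB : 2 * B ≤ A)
    (n : ℕ) (j : ℤ) :
    (((p - 1)! : ℕ) : ℤ) *
        ((((∏ m ∈ (Icc 1 (n * p)).filter (fun m => ¬ p ∣ m), m : ℕ) : ℤ) ^ (A - 2 * B) *
          (∏ m ∈ (Icc 1 (n * p)).filter (fun m => ¬ p ∣ m), (j * p + (m : ℤ))) ^ B *
          (∏ m ∈ (Icc 1 (n * p)).filter (fun m => ¬ p ∣ m), (((n : ℤ) - j) * p + (m : ℤ))) ^ B)) ≡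
      (∏ m ∈ (Icc 1 (n * p)).filter (fun m => ¬ p ∣ m), ((m : ℤ) - j * p)) ^ A *
        ((((p - 1)! : ℕ) : ℤ) +
          ((p * ∑ i ∈ Icc 1 (p - 1), (p - 1)! / i : ℕ) : ℤ) * phiMoment A B n j)
      [ZMOD (p : ℤ) ^ 4] := by
  obtain ⟨a, rfl⟩ : ∃ a, A = a + 2 * B := ⟨A - 2 * B, by omega⟩
  obtain ⟨u, hu⟩ := exists_inv_factorial (p := p) hp
  -- the four products as blocks
  have hW : (((∏ m ∈ (Icc 1 (n * p)).filter (fun m => ¬ p ∣ m), m : ℕ)) : ZMod (p ^ 4)) =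
      (((p - 1)! : ℕ) : ZMod (p ^ 4)) ^ n *
        (1 + ((blockMoment n 0 : ℤ) : ZMod (p ^ 4)) *
          (((p * ∑ i ∈ Icc 1 (p - 1), (p - 1)! / i : ℕ) : ZMod (p ^ 4)) * u)) := by
    rw [← cast_prod_filter_eq hp h3 hu n 0]
    push_cast
    exact Finset.prod_congr rfl fun m _ => by ring
  have hP1 := cast_prod_filter_eq hp h3 hu n j
  have hP2 := cast_prod_filter_eq hp h3 hu n ((n : ℤ) - j)
  have hD : (((∏ m ∈ (Icc 1 (n * p)).filter (fun m => ¬ p ∣ m), ((m : ℤ) - j * p)) : ℤ) : ZMod (p ^ 4)) =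
      (((p - 1)! : ℕ) : ZMod (p ^ 4)) ^ n *
        (1 + ((blockMoment n (-j) : ℤ) : ZMod (p ^ 4)) *
          (((p * ∑ i ∈ Icc 1 (p - 1), (p - 1)! / i : ℕ) : ZMod (p ^ 4)) * u)) := by
    rw [← cast_prod_filter_eq hp h3 hu n (-j)]
    congr 1
    exact Finset.prod_congr rfl fun m _ => by ring
  -- pass to `ℤ/p⁴`
  rw [(Nat.cast_pow p 4).symm]
  refine (ZMod.intCast_eq_intCast_iff _ _ (p ^ 4)).1 ?_
  simp only [Int.cast_mul, Int.cast_pow, Int.cast_add, Int.cast_natCast]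
  rw [hW, hP1, hP2, hD]
  simp only [phiMoment, Int.cast_add, Int.cast_sub, Int.cast_mul, Int.cast_natCast, Nat.add_sub_cancel,
    mul_pow, one_add_mul_pow (lambda_mul_sq hp h3 u)]
  linear_combination assembly (m₀ := ((blockMoment n 0 : ℤ) : ZMod (p ^ 4)))
    (m₁ := ((blockMoment n j : ℤ) : ZMod (p ^ 4))) (m₂ := ((blockMoment n ((n : ℤ) - j) : ℤ) : ZMod (p ^ 4)))
    (m₃ := ((blockMoment n (-j) : ℤ) : ZMod (p ^ 4))) (lambda_mul_lambda hp h3) hu n a B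

/-- `∏_{1≤ℓ≤np, p∤ℓ}(−1) = 1` for an odd prime `p` (the sign of `∏(−jp − ℓ)`: `n(p−1)` factors). -/
private theorem prod_filter_neg_one {R : Type*} [CommRing R] (hp : p.Prime) (h2 : p ≠ 2) (n : ℕ) :
    ∏ _m ∈ (Icc 1 (n * p)).filter (fun m => ¬ p ∣ m), (-1 : R) = 1 := by
  rw [prod_filter_not_dvd_eq_prod_prod hp.pos n (fun _ => (-1 : R))]
  refine Finset.prod_eq_one fun b _ => ?_
  rw [Finset.prod_const, Nat.card_Icc, show p - 1 + 1 - 1 = p - 1 by omega]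
  exact (hp.even_sub_one h2).neg_one_pow

end blocks

/-! ## LEMMA Φ4 for `brickPhi` over `ℚ` -/

section rat

variable {p : ℕ} [Fact p.Prime]

/-- `v_p(z) ≤ 1` for an integer `z`. [folklore] -/
private theorem padicValuation_intCast_le_one (z : ℤ) : Rat.padicValuation p (z : ℚ) ≤ 1 := by
  rw [Rat.padicValuation_cast]; exact Int.padicValuation_le_one p z

/-- `v_p(z) = 1` for an integer `z` prime to `p`. [folklore] -/
private theorem padicValuation_intCast_eq_one {z : ℤ} (hz : ¬ (p : ℤ) ∣ z) : Rat.padicValuation p (z : ℚ) = 1 := by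
  rw [Rat.padicValuation_cast, Int.padicValuation_eq_one_iff]; exact hz

/-- `v_p((p−1)!) = 1` (i.e. `p ∤ (p−1)!`). [folklore] -/
private theorem padicValuation_factorial_eq_one : Rat.padicValuation p (((p - 1)! : ℕ) : ℚ) = 1 := by
  have hp : p.Prime := Fact.out
  rw [← Int.cast_natCast]
  refine padicValuation_intCast_eq_one fun h => ?_
  have h' : p ∣ (p - 1)! := Int.natCast_dvd_natCast.1 h
  rw [hp.dvd_factorial] at h'
  have := hp.one_lt
  omega

/-- **`v_p(λ_p) ≥ 3`**, `λ_p = p·H_{p−1} = p·(1 + ½ + ⋯ + 1/(p−1))`, for a prime `p ≥ 5` (Wolstenholme's theorem;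
tree: `Wolstenholme.sq_dvd_sum_factorial_div`, `Wolstenholme.sum_factorial_div`). -/
theorem padicValuation_prime_mul_harmonic_le (h3 : 3 < p) :
    Rat.padicValuation p ((p : ℚ) * harmonic (p - 1)) ≤ exp (-3) := by
  have hp : p.Prime := Fact.out
  obtain ⟨c, hc⟩ := Wolstenholme.sq_dvd_sum_factorial_div hp h3
  have hsum := Wolstenholme.sum_factorial_div p
  have hF0 : (((p - 1)! : ℕ) : ℚ) ≠ 0 := by positivity
  have e : (p : ℚ) * harmonic (p - 1) = (p : ℚ) ^ 3 * (c : ℚ) / (((p - 1)! : ℕ) : ℚ) := by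
    rw [hc] at hsum; push_cast at hsum
    rw [eq_div_iff hF0]; linear_combination (p : ℚ) * hsum.symm
  rw [e, map_div₀, map_mul, map_pow, Rat.padicValuation_self, padicValuation_factorial_eq_one, div_one,
    ← exp_nsmul]
  have hc1 : Rat.padicValuation p (c : ℚ) ≤ 1 := by exact_mod_cast padicValuation_intCast_le_one (p := p) c
  calc exp (3 • (-1 : ℤ)) * Rat.padicValuation p (c : ℚ) ≤ exp (3 • (-1 : ℤ)) * 1 := by gcongr
    _ = exp (-3) := by rw [mul_one]; norm_num

/-- **LEMMA Φ4** (zi-p2 LEMMAS §B8-a′; the input of THEOREM 5 Step D): for a prime `p ≥ 5`, `2B ≤ A`, every `n`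
and every `j ∈ ℤ`, the Frobenius factor of the brick kernel `(A,B,·)` satisfies `v_p(Φ_{n,p}(−j) − 1 − λ_p·q) ≥ 4`,
`λ_p = p·H_{p−1}` (`j`-independent, `v_p(λ_p) ≥ 3`: `padicValuation_prime_mul_harmonic_le`), `q = phiMoment A B n j`
(`= qBall A B n j` for `0 ≤ j ≤ n`: `phiMoment_natCast_eq_qBall`) — `Φ_{n,p}(−j) ≡ 1 + λ_p·q_n(j) (mod p⁴)`. -/
theorem padicValuation_brickPhi_sub_le (h3 : 3 < p) {A B : ℕ} (hAB : 2 * B ≤ A) (n : ℕ) (j : ℤ) :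
    Rat.padicValuation p
        (brickPhi A B p n (-(j : ℚ)) - 1 - (p : ℚ) * harmonic (p - 1) * (phiMoment A B n j : ℚ)) ≤
      exp (-4) := by
  have hp : p.Prime := Fact.out
  have h2 : p ≠ 2 := by omega
  have hmain := (factorial_mul_num_modEq_den_mul hp h3 hAB n j).symm.dvd
  have hpD := not_dvd_prod_filter_sub_mul hp h3 n j
  set W : ℕ := ∏ m ∈ (Icc 1 (n * p)).filter (fun m => ¬ p ∣ m), m with hWdef
  set P₁ : ℤ := ∏ m ∈ (Icc 1 (n * p)).filter (fun m => ¬ p ∣ m), (j * p + (m : ℤ)) with hP₁def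
  set P₂ : ℤ := ∏ m ∈ (Icc 1 (n * p)).filter (fun m => ¬ p ∣ m), (((n : ℤ) - j) * p + (m : ℤ)) with hP₂def
  set D : ℤ := ∏ m ∈ (Icc 1 (n * p)).filter (fun m => ¬ p ∣ m), ((m : ℤ) - j * p) with hDdef
  set F : ℕ := (p - 1)! with hFdef
  set Ap : ℕ := ∑ i ∈ Icc 1 (p - 1), (p - 1)! / i with hApdef
  obtain ⟨k, hk⟩ := hmain
  -- `Φ_{n,p}(−j) = W^{A−2B} P₁^B P₂^B / D^A`
  have e1 : ∏ m ∈ (Icc 1 (n * p)).filter (fun m => ¬ p ∣ m), ((p : ℚ) * (-(j : ℚ)) - (m : ℚ)) = (P₁ : ℚ) := by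
    rw [hP₁def, Int.cast_prod, ← one_mul (∏ m ∈ (Icc 1 (n * p)).filter (fun m => ¬ p ∣ m),
      (((j * p + (m : ℤ) : ℤ)) : ℚ)), ← prod_filter_neg_one (R := ℚ) hp h2 n, ← Finset.prod_mul_distrib]
    exact Finset.prod_congr rfl fun m _ => by push_cast; ring
  have e2 : ∏ m ∈ (Icc 1 (n * p)).filter (fun m => ¬ p ∣ m), ((p : ℚ) * (-(j : ℚ)) + ((n * p : ℕ) : ℚ) + (m : ℚ))
      = (P₂ : ℚ) := by
    rw [hP₂def, Int.cast_prod]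
    exact Finset.prod_congr rfl fun m _ => by push_cast; ring
  have e3 : ∏ m ∈ (Icc 1 (n * p)).filter (fun m => ¬ p ∣ m), ((p : ℚ) * (-(j : ℚ)) + (m : ℚ)) = (D : ℚ) := by
    rw [hDdef, Int.cast_prod]
    exact Finset.prod_congr rfl fun m _ => by push_cast; ring
  have hΦ : brickPhi A B p n (-(j : ℚ)) = (W : ℚ) ^ (A - 2 * B) * (P₁ : ℚ) ^ B * (P₂ : ℚ) ^ B / (D : ℚ) ^ A := by
    rw [brickPhi, e1, e2, e3]
  -- denominators
  have hF0 : (F : ℚ) ≠ 0 := by positivity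
  have hD0 : (D : ℚ) ≠ 0 := fun h => hpD (by rw [show D = 0 by exact_mod_cast h]; exact dvd_zero _)
  have hharm : (p : ℚ) * harmonic (p - 1) = ((p * Ap : ℕ) : ℚ) / (F : ℚ) := by
    rw [eq_div_iff hF0]
    have hsum := Wolstenholme.sum_factorial_div p
    rw [← hApdef, ← hFdef] at hsum
    push_cast
    linear_combination (p : ℚ) * hsum.symm
  have hkQ : ((F : ℤ) : ℚ) * ((W : ℚ) ^ (A - 2 * B) * (P₁ : ℚ) ^ B * (P₂ : ℚ) ^ B) -
      (D : ℚ) ^ A * ((F : ℚ) + ((p * Ap : ℕ) : ℚ) * (phiMoment A B n j : ℚ)) = (p : ℚ) ^ 4 * (k : ℚ) := by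
    have h := congrArg (Int.cast : ℤ → ℚ) hk
    push_cast at h ⊢
    linear_combination h
  have hval : brickPhi A B p n (-(j : ℚ)) - 1 - (p : ℚ) * harmonic (p - 1) * (phiMoment A B n j : ℚ) =
      (p : ℚ) ^ 4 * (k : ℚ) / ((F : ℚ) * (D : ℚ) ^ A) := by
    rw [hΦ, hharm, eq_div_iff (mul_ne_zero hF0 (pow_ne_zero _ hD0)), ← hkQ]
    field_simp
    push_cast
    ring
  rw [hval, map_div₀, map_mul, map_mul, map_pow, map_pow, Rat.padicValuation_self, padicValuation_factorial_eq_one,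
    padicValuation_intCast_eq_one hpD, one_pow, mul_one, div_one, ← exp_nsmul]
  calc exp (4 • (-1 : ℤ)) * Rat.padicValuation p (k : ℚ) ≤ exp (4 • (-1 : ℤ)) * 1 := by
        gcongr; exact padicValuation_intCast_le_one k
    _ = exp (-4) := by rw [mul_one]; norm_num

end rat

/-! ## Sanity instances -/

/-- the moment at `(A,B,n,j) = (4,1,1,0)`: `q = 2·M_1(0) + M_1(0) + M_1(1) − 4·M_1(0) = 2`. -/
example : phiMoment 4 1 1 0 = 2 := by simp [phiMoment, blockMoment]

/-- … and zi-p2's cubic there: `qBall 4 1 1 0 = S(0,0) + S(1,1) − 4(S(0,0) + S(0,0)) + 2·S(0,0) = 2`. -/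
example : qBall 4 1 1 0 = 2 := by simp [qBall, S2]

end Summit.KontsevichZagierPeriods.Zeta5Search.BrickPhiFour
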